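import Literature.MathematicalPhysics.QuantumFieldTheory.Balaban1983to89.Beta.FibreInverseDecay
import Literature.MathematicalPhysics.QuantumFieldTheory.Balaban1983to89.Beta.PolarizationSign

/-!
# `Balaban1983to89.Beta.FibreLiouville` — POLYNOMIAL LIOUVILLE, GREEN'S REPRESENTATION OF TEMPERED CONFIGURATIONS,
EXISTENCE, UNIQUENESS and REALNESS of tempered solutions / of the fundamental solution, for a finite-difference system on `ℤ^{d+1}` whose
Floquet–Bloch fibre matrices are nonsingular at every REAL momentum (β sub-cell row BETA-lit2, unit
`b2b-balaban-beta-lit2` gen 11; the cell label **(Liouville-KKT)** in the nonsingular-fibre case)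

HONEST FRAMING (cell `pub-balaban`, BETA-SPEC, verbatim): discharging `BetaPertH` makes Bałaban's UV stability
UNCONDITIONAL — a real constructive-QFT result; it is NOT the continuum limit and NOT the Clay problem.  This module is a
GENERIC ([folklore]) engine of lattice Fourier analysis / linear algebra; it asserts NOTHING about Bałaban's propagators,
minimisers or β-functions (1.22), contains no `def … : Prop` fact, cites no theorem as a hypothesis, and is NOT summit
progress.

ABSOLUTE RULE (cell, verbatim): no internally-minted statement may enter as a cited fact; every hypothesis is either
kernel-proved in this package or a verbatim quotation of a PUBLISHED theorem with page reference; the manuscripts under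
audit are NOT citable for their own disputed steps.  Nothing below is cited; everything is proved.

CITATION HEADER (lean-in-tree rule; CONTEXT ONLY — neither statement is used).  The printed form of the principle made
kernel here is the lattice (graph) case of the Floquet–Liouville theorem: P. Kuchment, Y. Pinchover, *Liouville theorems
and spectral edge behavior on abelian coverings of compact manifolds*, Trans. Amer. Math. Soc. **359** (2007) 5777–5815,
Theorem 4.3 p. 5796 («Pu = 0 has a nonzero polynomially growing solution iff … the real Fermi surface is not empty»,
elliptic systems) and Theorem 7.1 pp. 5807–5808 (periodic finite-order difference operators on abelian coverings of
finite graphs; «stated without a proof»); P. Kuchment, *An overview of periodic elliptic operators*, Bull. AMS **53**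
(2016) §4.2 / §8.2 [Kuchment2016] (cell records CITED-FACTS S-lit2g8-1, S-lit2g8-2, S-lit2g10-1; `HOME/BETA/TRANSFER.md` §23, §26).
What is proved below is the EASY DIRECTION in the case the β sub-cell's route P1-K realises — EMPTY real Fermi
surface, i.e. `det A(p) ≠ 0` for every real `p` — by the convolution-algebra argument «`u = K ∗ 𝕃u` for tempered `u`,
`K` the exponentially decaying two-sided fundamental solution» (no Floquet transform of distributions is needed).

SETTING (that of `Beta/FibreInverseDecay` §4–§5, imported untouched).  A finite stencil `S ⊂ ℤ^{d+1}`, matrix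
coefficients `L : ℤ^{d+1} → Mat_n(ℂ)` over a GENERIC finite index type `n`, the operator on vector configurations
`u : ℤ^{d+1} → (n → ℂ)`
    `(𝕃u)(x) = Σ_{a ∈ S} L_a · u(x + a)`                                           (`stencilApply S L u x`)
(the block-coordinate form of a finite-range operator commuting with a sublattice of translations — an2's
`BlochFibreMatrix.cfgFun_shiftCfg_eq_sum` is literally this shape), its fibre matrices `A(p) = Σ_a e^{ip·a} L_a`
(`FibreInverseDecay.trigPolySymbol S L p`), the nonsingularity hypothesis
    `hdet : ∀ s ∈ BZ (d+1), det (trigPolySymbol S L (ofRealVec s)) ≠ 0`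
(= an2's `det_trigPolySymbol_ne_zero`, from `BlochFibreUniqueness.blochFibre_uniqueness`), and the inverse kernel
`K = FibreInverseDecay.invKernel S L` with its landed properties `invKernel_decay_l1` (exponential decay in `|x|₁`),
`fundamental_left` (`Σ_a L_a K(x+a) = δ_{x,0}·1`) and `fundamental_right` (`Σ_a K(x+a) L_a = δ_{x,0}·1`).
Growth class: `PolyBdd u := ∃ C m, ∀ x k, ‖u x k‖ ≤ C (1 + |x|₁)^m` (`|x|₁ = B12Sec2to5.l1 x`).

WHAT THIS MODULE PROVES ([folklore]; every theorem kernel-checked here).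
§1  `stencilApply`, `PolyBdd` + closure (`PolyBdd.sub`, `PolyBdd.of_bounded`), `one_add_l1_sub_le_mul`
    (`1 + |x − z|₁ ≤ (1 + |x|₁)(1 + |z|₁)`), and THE SUMMABILITY ENGINE `summable_decay_mul_poly`: an exponentially
    decaying scalar kernel convolved with a polynomially bounded function is absolutely summable at every point
    (majorant `(1+s)^m e^{−δs} ≤ K_m e^{−δs/2}` = `PolarizationSign.one_add_pow_mul_exp_neg_le`, summed by b03's
    `B12Sec2to5.summable_exp_neg_l1`).
§2  GREEN'S REPRESENTATION OF TEMPERED CONFIGURATIONS `green_representation_apply` / `green_representation`: under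
    `hdet`, every `PolyBdd u` satisfies
        `u x = Σ'_z K(z) · (𝕃u)(x − z)`
    (the series is absolutely convergent, `summable_green_term`).  Proof: expand `u(x) = Σ_y [Σ_a K(y+a) L_a] u(x−y)` by
    `fundamental_right`, exchange the finite sums with the `ℤ^{d+1}`-sum (§1 engine), re-index `y = z − a`
    (`Equiv.addRight`), regroup.
§3  POLYNOMIAL LIOUVILLE `eq_zero_of_stencilApply_eq_zero`: `PolyBdd u ∧ 𝕃u = 0 ⟹ u = 0`; uniqueness of tempered
    solutions `eq_of_stencilApply_eq`: `PolyBdd u ∧ PolyBdd v ∧ 𝕃u = 𝕃v ⟹ u = v`.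
§4  UNIQUENESS OF THE TEMPERED FUNDAMENTAL SOLUTION `eq_invKernel_of_fundamental_left`: a matrix kernel
    `K′ : ℤ^{d+1} → Mat_n(ℂ)` with polynomially bounded entries and `Σ_a L_a K′(x+a) = δ_{x,0}·1` IS `invKernel S L`
    (columns are tempered solutions with the same right-hand sides; `polyBdd_invKernel_col`); the right form
    `eq_invKernel_of_fundamental_right` (`Σ_a K′(x+a) L_a = δ_{x,0}·1`) by transposition (`trigPolySymbol_transpose`,
    `invKernel_transpose`).
§5  REALNESS `conj_invKernel` / `invKernel_im_eq_zero`: if every coefficient matrix `L_a` has real entries, `K(x)` has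
    real entries (the entrywise conjugate of `K` is another bounded fundamental solution, §4); `fundamental_left_re`:
    the REAL kernel `(K(x)_{ij}).re` is a fundamental solution of the real system
    `Σ_a Σ_l Re(L_a)_{kl} Re K(x+a)_{lj} = δ_{x,0}δ_{kj}` — the form a real-valued kernel family
    (`KernelRepresentationSummable.kernelOpSum N w`, `w` real) consumes, with no re/im bookkeeping left;
    `abs_re_invKernel_le` / `decay510_re_invKernel` (its (5.10)-shape decay from `invKernel_decay_l1`, also in the cell's
    typing `B12Sec2to5.Decay510`, the hypothesis of `DecimatedMomentSummable.absMoment₂_of_decay510`).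
§6  EXISTENCE — THE GREEN POTENTIAL `greenPotential S L f x := Σ'_z K(z) · f(x − z)`: for tempered `f` it is summable
    (`summable_potential`), TEMPERED OF THE SAME DEGREE (`polyBdd_greenPotential`, via the explicit norm bound
    `norm_tsum_decay_mul_poly_le`) and SOLVES `𝕃(K ∗ f) = f` (`stencilApply_greenPotential`, by `fundamental_left`); with §3:
    `eq_greenPotential_of_stencilApply_eq` and `existsUnique_tempered_solution` — for every tempered right-hand side there
    is EXACTLY ONE tempered solution, the Green potential.  (This is the generic form of route P1-K's step (D4)(iii) «H, Φ,
    Ψ := absolutely convergent kernel sums on affine data satisfy the spec BY CONSTRUCTION»: in block coordinates an2's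
    KKT operator is `stencilApply S pieceMatrix` (`cfgFun_shiftCfg_eq_sum`) and affine data give a right-hand side of
    linear growth.)

CONSUMERS (honest).  NOT on the `hid` critical path of RULING (R14-1)/(R14-3) (route P1-K BUILDS the instance and
`hrep` holds by construction).  (i) an2's `Beta/AffineAveraging` header, «WHAT THIS FILE DOES NOT CLAIM (i)»: «that an
affine form IS the (unique) solution of the constrained problem for its data needs uniqueness in a class of polynomially
bounded configurations on ℤ^d — an ANALYTIC statement (cell label (Liouville-KKT)) not formalised here» — §3 is that
statement for every system of the shape above, so once (D4)(i) (`BlochFibreMatrix`: the KKT operator in block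
coordinates + `det ≠ 0`) lands, the affine lift is THE tempered solution for affine data and ANY tempered solution
operator of the typed system coincides with the kernel-sum instance on such data; (ii) the identification step of the
ruled fallback P1-α (BETA-SPEC §7.25 (R14-1)); (iii) §5 for (D4)(iii) (`w` real).  No N-uniformity of any constant is
claimed (the growth constants and the decay rate depend on the stencil data, exactly as in `FibreInverseDecay`).

WHAT IS NOT HERE.  The converse direction of Kuchment–Pinchover (nonempty Fermi surface ⟹ existence of polynomially
growing solutions, dimension counts Thm 4.4/4.5, Kha–Kuchment Thm 1.11); singular fibres (`p` with `det A(p) = 0`, e.g.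
pure Laplacians — there the Bloch-periodic Liouville theorems of `QuantumFieldTheory/BlochPeriodicCochains` (lit2 gen 8)
are the tool); anything about Bałaban's operators, (1.22), `hident`, the window legs or the remainder leaves; N-uniform
estimates.  References (CONTEXT ONLY): Kuchment–Pinchover, TAMS 359 (2007) 5777–5815; Kuchment, Bull. AMS 53 (2016)
343–414; cell records `HOME/BETA/TRANSFER.md` §23/§26/§27, `HOME/BETA/LIT2.md` v3.7, GAPS C-lit2g11-1.
-/

namespace Literature.MathematicalPhysics.QuantumFieldTheory.Balaban1983to89.Beta.FibreLiouville

open Complex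
open Literature.MathematicalPhysics.QuantumFieldTheory.Balaban1983to89.B4Strip (ofRealVec)
open Literature.MathematicalPhysics.QuantumFieldTheory.Balaban1983to89.B4ContourShift (BZ)
open Literature.MathematicalPhysics.QuantumFieldTheory.Balaban1983to89.B12Sec2to5 (l1 l1_nonneg summable_exp_neg_l1)
open Literature.MathematicalPhysics.QuantumFieldTheory.Balaban1983to89.Beta.FibreInverseDecay
open Literature.MathematicalPhysics.QuantumFieldTheory.Balaban1983to89.Beta.PolarizationSign (one_add_pow_mul_exp_neg_le)
open scoped BigOperators

noncomputable section

variable {d : ℕ} {n : Type*} [Fintype n] [DecidableEq n]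

/-! ### §1. The stencil operator, polynomial growth, and the summability engine -/

/-- the finite-difference operator `(𝕃u)(x) = Σ_{a ∈ S} L_a · u(x + a)` on vector configurations
`u : ℤ^{d+1} → (n → ℂ)` (block-coordinate form of a finite-range operator commuting with a sublattice). [folklore] -/
def stencilApply (S : Finset (Fin (d + 1) → ℤ)) (L : (Fin (d + 1) → ℤ) → Matrix n n ℂ)
    (u : (Fin (d + 1) → ℤ) → n → ℂ) (x : Fin (d + 1) → ℤ) : n → ℂ :=
  ∑ a ∈ S, (L a).mulVec (u (x + a))

omit [DecidableEq n] in
/-- componentwise unfolding of the stencil operator. [folklore] -/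
theorem stencilApply_apply (S : Finset (Fin (d + 1) → ℤ)) (L : (Fin (d + 1) → ℤ) → Matrix n n ℂ)
    (u : (Fin (d + 1) → ℤ) → n → ℂ) (x : Fin (d + 1) → ℤ) (k : n) :
    stencilApply S L u x k = ∑ a ∈ S, ∑ l, L a k l * u (x + a) l := by
  unfold stencilApply
  rw [Finset.sum_apply]
  rfl

omit [DecidableEq n] in
/-- the stencil operator respects differences … [folklore] -/
theorem stencilApply_sub (S : Finset (Fin (d + 1) → ℤ)) (L : (Fin (d + 1) → ℤ) → Matrix n n ℂ)
    (u v : (Fin (d + 1) → ℤ) → n → ℂ) :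
    stencilApply S L (u - v) = stencilApply S L u - stencilApply S L v := by
  funext x
  unfold stencilApply
  rw [Pi.sub_apply, ← Finset.sum_sub_distrib]
  refine Finset.sum_congr rfl fun a _ => ?_
  rw [Pi.sub_apply, Matrix.mulVec_sub]

omit [DecidableEq n] in
/-- … and kills the zero configuration. [folklore] -/
theorem stencilApply_zero (S : Finset (Fin (d + 1) → ℤ)) (L : (Fin (d + 1) → ℤ) → Matrix n n ℂ) :
    stencilApply S L (0 : (Fin (d + 1) → ℤ) → n → ℂ) = 0 := by
  funext x
  unfold stencilApply
  exact Finset.sum_eq_zero fun a _ => by rw [Pi.zero_apply, Matrix.mulVec_zero]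

/-- POLYNOMIAL GROWTH (tempered configurations): `‖u(x)_k‖ ≤ C (1 + |x|₁)^m`. [folklore] -/
def PolyBdd (u : (Fin (d + 1) → ℤ) → n → ℂ) : Prop :=
  ∃ C : ℝ, ∃ m : ℕ, ∀ x k, ‖u x k‖ ≤ C * (1 + l1 x) ^ m

/-- `1 + |x|₁ ≥ 1`. [folklore] -/
theorem one_le_one_add_l1 (x : Fin (d + 1) → ℤ) : 1 ≤ 1 + l1 x := by
  have := l1_nonneg x
  linarith

omit [Fintype n] [DecidableEq n] in
/-- bounded configurations are polynomially bounded (degree `0`). [folklore] -/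
theorem PolyBdd.of_bounded {u : (Fin (d + 1) → ℤ) → n → ℂ} {B : ℝ} (h : ∀ x k, ‖u x k‖ ≤ B) : PolyBdd u :=
  ⟨B, 0, fun x k => by rw [pow_zero, mul_one]; exact h x k⟩

omit [Fintype n] [DecidableEq n] in
/-- the zero configuration is polynomially bounded. [folklore] -/
theorem PolyBdd.zero : PolyBdd (0 : (Fin (d + 1) → ℤ) → n → ℂ) :=
  PolyBdd.of_bounded (B := 0) fun x k => by simp

omit [Fintype n] [DecidableEq n] in
/-- differences of polynomially bounded configurations are polynomially bounded. [folklore] -/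
theorem PolyBdd.sub {u v : (Fin (d + 1) → ℤ) → n → ℂ} (hu : PolyBdd u) (hv : PolyBdd v) : PolyBdd (u - v) := by
  obtain ⟨C₁, m₁, h₁⟩ := hu
  obtain ⟨C₂, m₂, h₂⟩ := hv
  refine ⟨|C₁| + |C₂|, m₁ + m₂, fun x k => ?_⟩
  have hb := one_le_one_add_l1 x
  have hp₁ : (1 + l1 x) ^ m₁ ≤ (1 + l1 x) ^ (m₁ + m₂) := pow_le_pow_right₀ hb (Nat.le_add_right _ _)
  have hp₂ : (1 + l1 x) ^ m₂ ≤ (1 + l1 x) ^ (m₁ + m₂) := pow_le_pow_right₀ hb (Nat.le_add_left _ _)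
  have hq₁ : 0 ≤ (1 + l1 x) ^ m₁ := pow_nonneg (by linarith) _
  have hq₂ : 0 ≤ (1 + l1 x) ^ m₂ := pow_nonneg (by linarith) _
  calc ‖(u - v) x k‖ = ‖u x k - v x k‖ := rfl
    _ ≤ ‖u x k‖ + ‖v x k‖ := norm_sub_le _ _
    _ ≤ C₁ * (1 + l1 x) ^ m₁ + C₂ * (1 + l1 x) ^ m₂ := add_le_add (h₁ x k) (h₂ x k)
    _ ≤ |C₁| * (1 + l1 x) ^ m₁ + |C₂| * (1 + l1 x) ^ m₂ :=
        add_le_add (mul_le_mul_of_nonneg_right (le_abs_self _) hq₁) (mul_le_mul_of_nonneg_right (le_abs_self _) hq₂)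
    _ ≤ |C₁| * (1 + l1 x) ^ (m₁ + m₂) + |C₂| * (1 + l1 x) ^ (m₁ + m₂) :=
        add_le_add (mul_le_mul_of_nonneg_left hp₁ (abs_nonneg _)) (mul_le_mul_of_nonneg_left hp₂ (abs_nonneg _))
    _ = (|C₁| + |C₂|) * (1 + l1 x) ^ (m₁ + m₂) := by ring

/-- `|x − z|₁ ≤ |x|₁ + |z|₁`, in the multiplicative form used by the engine: `1 + |x − z|₁ ≤ (1 + |x|₁)(1 + |z|₁)`.
[folklore] -/
theorem one_add_l1_sub_le_mul (x z : Fin (d + 1) → ℤ) : 1 + l1 (x - z) ≤ (1 + l1 x) * (1 + l1 z) := by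
  have htri : l1 (x - z) ≤ l1 x + l1 z := by
    unfold l1
    rw [← Finset.sum_add_distrib]
    refine Finset.sum_le_sum fun μ _ => ?_
    rw [Pi.sub_apply, Int.cast_sub]
    exact abs_sub _ _
  have hx := l1_nonneg x
  have hz := l1_nonneg z
  nlinarith

/-- the constant of the polynomial-vs-exponential majorant `(1+s)^m e^{−δs} ≤ K_m(δ) e^{−δs/2}`
(`PolarizationSign.one_add_pow_mul_exp_neg_le`). [folklore] -/
def polyExpConst (m : ℕ) (δ : ℝ) : ℝ := (m.factorial : ℝ) * Real.exp (δ / 2) / (δ / 2) ^ m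

/-- `K_m(δ) ≥ 0` for `δ > 0`. [folklore] -/
theorem polyExpConst_nonneg (m : ℕ) {δ : ℝ} (hδ : 0 < δ) : 0 ≤ polyExpConst m δ := by
  unfold polyExpConst
  positivity

/-- the nonnegativity of a decay constant read off at the origin. [folklore] -/
theorem decayConst_nonneg {g : (Fin (d + 1) → ℤ) → ℂ} {M δ : ℝ} (hg : ∀ z, ‖g z‖ ≤ M * Real.exp (-(δ * l1 z))) :
    0 ≤ M := by
  have h0 := hg 0
  have he : Real.exp (-(δ * l1 (0 : Fin (d + 1) → ℤ))) = 1 := by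
    rw [show l1 (0 : Fin (d + 1) → ℤ) = 0 by simp [l1], mul_zero, neg_zero, Real.exp_zero]
  rw [he, mul_one] at h0
  exact (norm_nonneg _).trans h0

/-- the nonnegativity of a growth constant read off at the origin. [folklore] -/
theorem growthConst_nonneg {h : (Fin (d + 1) → ℤ) → ℂ} {C : ℝ} {m : ℕ} (hh : ∀ z, ‖h z‖ ≤ C * (1 + l1 z) ^ m) :
    0 ≤ C := by
  have h0 := hh 0
  have hp : 0 < (1 + l1 (0 : Fin (d + 1) → ℤ)) ^ m := pow_pos (by linarith [l1_nonneg (0 : Fin (d + 1) → ℤ)]) m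
  nlinarith [norm_nonneg (h 0)]

/-- THE POINTWISE MAJORANT behind the engine: `‖g(z) h(x − z)‖ ≤ [M C K_m (1+|x|₁)^m] · e^{−(δ/2)|z|₁}`. [folklore] -/
theorem norm_decay_mul_poly_le {g h : (Fin (d + 1) → ℤ) → ℂ} {M δ C : ℝ} {m : ℕ} (hδ : 0 < δ)
    (hg : ∀ z, ‖g z‖ ≤ M * Real.exp (-(δ * l1 z))) (hh : ∀ z, ‖h z‖ ≤ C * (1 + l1 z) ^ m)
    (x z : Fin (d + 1) → ℤ) :
    ‖g z * h (x - z)‖ ≤ (M * C * polyExpConst m δ * (1 + l1 x) ^ m) * Real.exp (-(δ / 2) * l1 z) := by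
  have hC : 0 ≤ C := growthConst_nonneg hh
  have hM : 0 ≤ M := decayConst_nonneg hg
  have hxz := one_add_l1_sub_le_mul x z
  have h1xz : 0 ≤ 1 + l1 (x - z) := by linarith [l1_nonneg (x - z)]
  have hpow : (1 + l1 (x - z)) ^ m ≤ (1 + l1 x) ^ m * (1 + l1 z) ^ m := by
    rw [← mul_pow]
    exact pow_le_pow_left₀ h1xz hxz m
  have hpe : (1 + l1 z) ^ m * Real.exp (-δ * l1 z) ≤ polyExpConst m δ * Real.exp (-(δ / 2) * l1 z) :=
    one_add_pow_mul_exp_neg_le hδ m (l1_nonneg z)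
  have hexp : Real.exp (-(δ * l1 z)) = Real.exp (-δ * l1 z) := by rw [neg_mul]
  have hMe : 0 ≤ M * Real.exp (-(δ * l1 z)) := (norm_nonneg _).trans (hg z)
  rw [norm_mul]
  calc ‖g z‖ * ‖h (x - z)‖
      ≤ (M * Real.exp (-(δ * l1 z))) * (C * (1 + l1 (x - z)) ^ m) :=
        mul_le_mul (hg z) (hh (x - z)) (norm_nonneg _) hMe
    _ ≤ (M * Real.exp (-(δ * l1 z))) * (C * ((1 + l1 x) ^ m * (1 + l1 z) ^ m)) :=
        mul_le_mul_of_nonneg_left (mul_le_mul_of_nonneg_left hpow hC) hMe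
    _ = (M * Real.exp (-(δ * l1 z)) * (C * (1 + l1 x) ^ m)) * (1 + l1 z) ^ m := by ring
    _ = (M * Real.exp (-δ * l1 z) * (C * (1 + l1 x) ^ m)) * (1 + l1 z) ^ m := by rw [hexp]
    _ = M * (C * (1 + l1 x) ^ m) * ((1 + l1 z) ^ m * Real.exp (-δ * l1 z)) := by ring
    _ ≤ M * (C * (1 + l1 x) ^ m) * (polyExpConst m δ * Real.exp (-(δ / 2) * l1 z)) :=
        mul_le_mul_of_nonneg_left hpe (mul_nonneg hM (mul_nonneg hC (pow_nonneg (by linarith [l1_nonneg x]) m)))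
    _ = (M * C * polyExpConst m δ * (1 + l1 x) ^ m) * Real.exp (-(δ / 2) * l1 z) := by ring

/-- THE SUMMABILITY ENGINE: an exponentially decaying scalar kernel (`‖g z‖ ≤ M e^{−δ|z|₁}`, `δ > 0`) convolved with a
polynomially bounded function (`‖h z‖ ≤ C (1 + |z|₁)^m`) is absolutely summable at every point `x`:
`Σ_z ‖g(z) h(x − z)‖ < ∞`. [folklore] -/
theorem summable_decay_mul_poly {g h : (Fin (d + 1) → ℤ) → ℂ} {M δ C : ℝ} {m : ℕ} (hδ : 0 < δ)
    (hg : ∀ z, ‖g z‖ ≤ M * Real.exp (-(δ * l1 z))) (hh : ∀ z, ‖h z‖ ≤ C * (1 + l1 z) ^ m)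
    (x : Fin (d + 1) → ℤ) : Summable (fun z => g z * h (x - z)) :=
  Summable.of_norm_bounded ((summable_exp_neg_l1 (half_pos hδ) (d + 1)).mul_left _)
    (fun z => norm_decay_mul_poly_le hδ hg hh x z)

/-- … with the NORM OF THE SUM bounded polynomially in `x` with the SAME degree:
`‖Σ'_z g(z) h(x − z)‖ ≤ [M C K_m Z_δ] (1 + |x|₁)^m`, `Z_δ = Σ_z e^{−(δ/2)|z|₁}`. [folklore] -/
theorem norm_tsum_decay_mul_poly_le {g h : (Fin (d + 1) → ℤ) → ℂ} {M δ C : ℝ} {m : ℕ} (hδ : 0 < δ)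
    (hg : ∀ z, ‖g z‖ ≤ M * Real.exp (-(δ * l1 z))) (hh : ∀ z, ‖h z‖ ≤ C * (1 + l1 z) ^ m)
    (x : Fin (d + 1) → ℤ) :
    ‖∑' z, g z * h (x - z)‖
      ≤ (M * C * polyExpConst m δ * ∑' z : Fin (d + 1) → ℤ, Real.exp (-(δ / 2) * l1 z)) * (1 + l1 x) ^ m := by
  have hmaj : Summable (fun z : Fin (d + 1) → ℤ =>
      (M * C * polyExpConst m δ * (1 + l1 x) ^ m) * Real.exp (-(δ / 2) * l1 z)) :=
    (summable_exp_neg_l1 (half_pos hδ) (d + 1)).mul_left _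
  calc ‖∑' z, g z * h (x - z)‖ ≤ ∑' z, ‖g z * h (x - z)‖ := norm_tsum_le_tsum_norm
          (Summable.of_nonneg_of_le (fun z => norm_nonneg _) (fun z => norm_decay_mul_poly_le hδ hg hh x z) hmaj)
    _ ≤ ∑' z : Fin (d + 1) → ℤ, (M * C * polyExpConst m δ * (1 + l1 x) ^ m) * Real.exp (-(δ / 2) * l1 z) :=
        Summable.tsum_le_tsum (fun z => norm_decay_mul_poly_le hδ hg hh x z)
          (Summable.of_nonneg_of_le (fun z => norm_nonneg _) (fun z => norm_decay_mul_poly_le hδ hg hh x z) hmaj) hmaj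
    _ = (M * C * polyExpConst m δ * ∑' z : Fin (d + 1) → ℤ, Real.exp (-(δ / 2) * l1 z)) * (1 + l1 x) ^ m := by
        rw [tsum_mul_left]; ring

/-- the engine after the translation `y = z − a`: `Σ_y ‖g(y + a) h(x − y)‖ < ∞`. [folklore] -/
theorem summable_decay_shift_mul_poly {g h : (Fin (d + 1) → ℤ) → ℂ} {M δ C : ℝ} {m : ℕ} (hδ : 0 < δ)
    (hg : ∀ z, ‖g z‖ ≤ M * Real.exp (-(δ * l1 z))) (hh : ∀ z, ‖h z‖ ≤ C * (1 + l1 z) ^ m)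
    (x a : Fin (d + 1) → ℤ) : Summable (fun y => g (y + a) * h (x - y)) := by
  have hs := summable_decay_mul_poly hδ hg hh (x + a)
  have heq : (fun y => g (y + a) * h (x - y)) = (fun z => g z * h (x + a - z)) ∘ (Equiv.addRight a) := by
    funext y
    simp only [Function.comp_apply, Equiv.coe_addRight]
    congr 2
    abel
  rw [heq]
  exact (Equiv.summable_iff (Equiv.addRight a)).mpr hs

/-! ### §2. Green's representation of tempered configurations: `u = K ∗ 𝕃u` -/

section Green

variable (S : Finset (Fin (d + 1) → ℤ)) (L : (Fin (d + 1) → ℤ) → Matrix n n ℂ)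

/-- the inverse kernel decays exponentially in `|x|₁`, entrywise with common constants (`FibreInverseDecay.invKernel_decay_l1`
restated with `B12Sec2to5.l1`, which is its coordinate sum by `rfl`). [folklore] -/
theorem invKernel_decay_l1' (hdet : ∀ s ∈ BZ (d + 1), (trigPolySymbol S L (ofRealVec s)).det ≠ 0) :
    ∃ δ M : ℝ, 0 < δ ∧ 0 ≤ M ∧ ∀ i j (x : Fin (d + 1) → ℤ),
      ‖invKernel S L x i j‖ ≤ M * Real.exp (-(δ * l1 x)) :=
  invKernel_decay_l1 S L hdet

omit [DecidableEq n] in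
/-- an entry of a matrix product is bounded through the entries: `‖(K B)_{kl}‖ ≤ M · Σ_{l'} ‖B_{l'l}‖` if
`‖K_{ij}‖ ≤ M`. [folklore] -/
theorem norm_mul_apply_le {K B : Matrix n n ℂ} {M : ℝ} (hK : ∀ i j, ‖K i j‖ ≤ M) (k l : n) :
    ‖(K * B) k l‖ ≤ M * ∑ l', ‖B l' l‖ := by
  rw [Matrix.mul_apply, Finset.mul_sum]
  refine (norm_sum_le _ _).trans (Finset.sum_le_sum fun l' _ => ?_)
  rw [norm_mul]
  exact mul_le_mul_of_nonneg_right (hK k l') (norm_nonneg _)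

/-- pointwise expansion of the Green term: `(K(z) · (𝕃u)(x − z))_k = Σ_{a ∈ S} Σ_l (K(z) L_a)_{kl} u(x − z + a)_l`.
[folklore] -/
theorem green_term_expand (u : (Fin (d + 1) → ℤ) → n → ℂ) (x z : Fin (d + 1) → ℤ) (k : n) :
    ((invKernel S L z).mulVec (stencilApply S L u (x - z))) k
      = ∑ a ∈ S, ∑ l, (invKernel S L z * L a) k l * u (x - z + a) l := by
  simp only [Matrix.mulVec, dotProduct, stencilApply_apply, Matrix.mul_apply, Finset.mul_sum, Finset.sum_mul]
  rw [Finset.sum_comm]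
  refine Finset.sum_congr rfl fun a _ => ?_
  rw [Finset.sum_comm]
  refine Finset.sum_congr rfl fun l _ => ?_
  refine Finset.sum_congr rfl fun l' _ => ?_
  ring

/-- the terms `(K(y+a) L_a)_{kl} u(x−y)_l` of the expanded representation are summable in `y`. [folklore] -/
theorem summable_expanded_term (hdet : ∀ s ∈ BZ (d + 1), (trigPolySymbol S L (ofRealVec s)).det ≠ 0)
    {u : (Fin (d + 1) → ℤ) → n → ℂ} (hu : PolyBdd u) (x a : Fin (d + 1) → ℤ) (k l : n) :
    Summable (fun y => (invKernel S L (y + a) * L a) k l * u (x - y) l) := by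
  obtain ⟨δ, M, hδ, _, hK⟩ := invKernel_decay_l1' S L hdet
  obtain ⟨C, m, hC⟩ := hu
  refine summable_decay_shift_mul_poly (g := fun z => (invKernel S L z * L a) k l) (h := fun w => u w l)
    (M := M * ∑ l', ‖L a l' l‖) hδ (fun z => ?_) (fun w => hC w l) x a
  calc ‖(invKernel S L z * L a) k l‖ ≤ (M * Real.exp (-(δ * l1 z))) * ∑ l', ‖L a l' l‖ :=
        norm_mul_apply_le (fun i j => hK i j z) k l
    _ = M * (∑ l', ‖L a l' l‖) * Real.exp (-(δ * l1 z)) := by ring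

/-- the terms `(K(z) L_a)_{kl} u(x − z + a)_l` (after re-indexing) are summable in `z`. [folklore] -/
theorem summable_reindexed_term (hdet : ∀ s ∈ BZ (d + 1), (trigPolySymbol S L (ofRealVec s)).det ≠ 0)
    {u : (Fin (d + 1) → ℤ) → n → ℂ} (hu : PolyBdd u) (x a : Fin (d + 1) → ℤ) (k l : n) :
    Summable (fun z => (invKernel S L z * L a) k l * u (x - z + a) l) := by
  obtain ⟨δ, M, hδ, _, hK⟩ := invKernel_decay_l1' S L hdet
  obtain ⟨C, m, hC⟩ := hu
  have hs := summable_decay_mul_poly (g := fun z => (invKernel S L z * L a) k l) (h := fun w => u w l)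
    (M := M * ∑ l', ‖L a l' l‖) hδ (fun z => ?_) (fun w => hC w l) (x + a)
  · refine hs.congr fun z => ?_
    rw [show x + a - z = x - z + a by abel]
  calc ‖(invKernel S L z * L a) k l‖ ≤ (M * Real.exp (-(δ * l1 z))) * ∑ l', ‖L a l' l‖ :=
        norm_mul_apply_le (fun i j => hK i j z) k l
    _ = M * (∑ l', ‖L a l' l‖) * Real.exp (-(δ * l1 z)) := by ring

/-- the GREEN TERM `z ↦ (K(z) · (𝕃u)(x − z))_k` is summable for tempered `u`. [folklore] -/
theorem summable_green_term (hdet : ∀ s ∈ BZ (d + 1), (trigPolySymbol S L (ofRealVec s)).det ≠ 0)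
    {u : (Fin (d + 1) → ℤ) → n → ℂ} (hu : PolyBdd u) (x : Fin (d + 1) → ℤ) (k : n) :
    Summable (fun z => ((invKernel S L z).mulVec (stencilApply S L u (x - z))) k) := by
  have heq : (fun z => ((invKernel S L z).mulVec (stencilApply S L u (x - z))) k)
      = fun z => ∑ a ∈ S, ∑ l, (invKernel S L z * L a) k l * u (x - z + a) l := by
    funext z
    exact green_term_expand S L u x z k
  rw [heq]
  refine summable_sum fun a _ => summable_sum fun l _ => ?_
  exact summable_reindexed_term S L hdet hu x a k l

/-- the vector-valued GREEN TERM `z ↦ K(z) · (𝕃u)(x − z)` is summable for tempered `u`. [folklore] -/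
theorem summable_green (hdet : ∀ s ∈ BZ (d + 1), (trigPolySymbol S L (ofRealVec s)).det ≠ 0)
    {u : (Fin (d + 1) → ℤ) → n → ℂ} (hu : PolyBdd u) (x : Fin (d + 1) → ℤ) :
    Summable (fun z => (invKernel S L z).mulVec (stencilApply S L u (x - z))) :=
  Pi.summable.mpr fun k => summable_green_term S L hdet hu x k

/-- **GREEN'S REPRESENTATION OF TEMPERED CONFIGURATIONS (componentwise).**  If the fibre matrices are nonsingular on the
real zone and `u` is polynomially bounded, then for every `x` and every component `k`
`u(x)_k = Σ'_{z ∈ ℤ^{d+1}} (K(z) · (𝕃u)(x − z))_k`. [folklore] -/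
theorem green_representation_apply (hdet : ∀ s ∈ BZ (d + 1), (trigPolySymbol S L (ofRealVec s)).det ≠ 0)
    {u : (Fin (d + 1) → ℤ) → n → ℂ} (hu : PolyBdd u) (x : Fin (d + 1) → ℤ) (k : n) :
    u x k = ∑' z, ((invKernel S L z).mulVec (stencilApply S L u (x - z))) k := by
  symm
  -- R0: expand the Green term
  have hR0 : (∑' z, ((invKernel S L z).mulVec (stencilApply S L u (x - z))) k)
      = ∑' z, ∑ a ∈ S, ∑ l, (invKernel S L z * L a) k l * u (x - z + a) l :=
    tsum_congr fun z => green_term_expand S L u x z k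
  -- R1–R2: finite sums out of the lattice sum
  have hR1 : (∑' z, ∑ a ∈ S, ∑ l, (invKernel S L z * L a) k l * u (x - z + a) l)
      = ∑ a ∈ S, ∑ l, ∑' z, (invKernel S L z * L a) k l * u (x - z + a) l := by
    rw [Summable.tsum_finsetSum (fun a _ => summable_sum fun l _ => summable_reindexed_term S L hdet hu x a k l)]
    refine Finset.sum_congr rfl fun a _ => ?_
    exact Summable.tsum_finsetSum fun l _ => summable_reindexed_term S L hdet hu x a k l
  -- R3: re-index `z = y + a`
  have hR3 : ∀ a ∈ S, ∀ l, (∑' z, (invKernel S L z * L a) k l * u (x - z + a) l)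
      = ∑' y, (invKernel S L (y + a) * L a) k l * u (x - y) l := by
    intro a _ l
    rw [← (Equiv.addRight a).tsum_eq (fun z => (invKernel S L z * L a) k l * u (x - z + a) l)]
    refine tsum_congr fun y => ?_
    simp only [Equiv.coe_addRight]
    congr 2
    abel
  have hR3' : (∑ a ∈ S, ∑ l, ∑' z, (invKernel S L z * L a) k l * u (x - z + a) l)
      = ∑ a ∈ S, ∑ l, ∑' y, (invKernel S L (y + a) * L a) k l * u (x - y) l := by
    refine Finset.sum_congr rfl fun a ha => Finset.sum_congr rfl fun l _ => hR3 a ha l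
  -- R4: lattice sum back outside
  have hR4 : (∑ a ∈ S, ∑ l, ∑' y, (invKernel S L (y + a) * L a) k l * u (x - y) l)
      = ∑' y, ∑ a ∈ S, ∑ l, (invKernel S L (y + a) * L a) k l * u (x - y) l := by
    rw [Summable.tsum_finsetSum (fun a _ => summable_sum fun l _ => summable_expanded_term S L hdet hu x a k l)]
    refine Finset.sum_congr rfl fun a _ => ?_
    exact (Summable.tsum_finsetSum fun l _ => summable_expanded_term S L hdet hu x a k l).symm
  -- R5–R6: regroup and use the fundamental-solution identity (right form)
  have hR5 : ∀ y, (∑ a ∈ S, ∑ l, (invKernel S L (y + a) * L a) k l * u (x - y) l)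
      = ∑ l, (if y = 0 then (1 : Matrix n n ℂ) else 0) k l * u (x - y) l := by
    intro y
    rw [Finset.sum_comm, ← fundamental_right S L hdet y]
    refine Finset.sum_congr rfl fun l _ => ?_
    rw [Matrix.sum_apply, Finset.sum_mul]
  have hR6 : (∑' y, ∑ a ∈ S, ∑ l, (invKernel S L (y + a) * L a) k l * u (x - y) l)
      = ∑' y, ∑ l, (if y = 0 then (1 : Matrix n n ℂ) else 0) k l * u (x - y) l :=
    tsum_congr hR5
  -- R7: only `y = 0` survives
  have hR7 : (∑' y, ∑ l, (if y = 0 then (1 : Matrix n n ℂ) else 0) k l * u (x - y) l) = u x k := by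
    rw [tsum_eq_single 0]
    · simp only [if_true, sub_zero, Matrix.one_apply, ite_mul, one_mul, zero_mul, Finset.sum_ite_eq,
        Finset.mem_univ]
    · intro y hy
      simp only [hy, if_false, Matrix.zero_apply, zero_mul, Finset.sum_const_zero]
  rw [hR0, hR1, hR3', hR4, hR6, hR7]

/-- **GREEN'S REPRESENTATION OF TEMPERED CONFIGURATIONS (vector form).**  `u(x) = Σ'_z K(z) · (𝕃u)(x − z)` for every
polynomially bounded `u`, the fibre matrices being nonsingular on the real zone. [folklore] -/
theorem green_representation (hdet : ∀ s ∈ BZ (d + 1), (trigPolySymbol S L (ofRealVec s)).det ≠ 0)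
    {u : (Fin (d + 1) → ℤ) → n → ℂ} (hu : PolyBdd u) (x : Fin (d + 1) → ℤ) :
    u x = ∑' z, (invKernel S L z).mulVec (stencilApply S L u (x - z)) := by
  funext k
  rw [tsum_apply (summable_green S L hdet hu x)]
  exact green_representation_apply S L hdet hu x k

/-! ### §3. Polynomial Liouville and uniqueness of tempered solutions -/

/-- **POLYNOMIAL LIOUVILLE THEOREM** (Kuchment–Pinchover Thm 7.1 / Thm 4.3, «empty real Fermi surface» direction, for
finite-difference systems with matrix trigonometric-polynomial symbol): if `det A(p) ≠ 0` for every real momentum `p`, a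
polynomially bounded configuration annihilated by `𝕃` vanishes identically. [folklore] -/
theorem eq_zero_of_stencilApply_eq_zero (hdet : ∀ s ∈ BZ (d + 1), (trigPolySymbol S L (ofRealVec s)).det ≠ 0)
    {u : (Fin (d + 1) → ℤ) → n → ℂ} (hu : PolyBdd u) (h0 : stencilApply S L u = 0) : u = 0 := by
  funext x k
  rw [green_representation_apply S L hdet hu x k, h0]
  simp only [Pi.zero_apply, Matrix.mulVec_zero, tsum_zero]

/-- **UNIQUENESS OF TEMPERED SOLUTIONS**: two polynomially bounded configurations with the same image under `𝕃`
coincide. [folklore] -/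
theorem eq_of_stencilApply_eq (hdet : ∀ s ∈ BZ (d + 1), (trigPolySymbol S L (ofRealVec s)).det ≠ 0)
    {u v : (Fin (d + 1) → ℤ) → n → ℂ} (hu : PolyBdd u) (hv : PolyBdd v)
    (h : stencilApply S L u = stencilApply S L v) : u = v := by
  have hz : stencilApply S L (u - v) = 0 := by rw [stencilApply_sub, h, sub_self]
  exact sub_eq_zero.mp (eq_zero_of_stencilApply_eq_zero S L hdet (hu.sub hv) hz)

/-- a tempered solution of `𝕃u = f` IS the Green potential `Σ'_z K(z) f(x − z)` of its right-hand side (a restatement of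
§2 emphasising that the representation depends on `u` only through `f = 𝕃u`). [folklore] -/
theorem eq_green_potential (hdet : ∀ s ∈ BZ (d + 1), (trigPolySymbol S L (ofRealVec s)).det ≠ 0)
    {u f : (Fin (d + 1) → ℤ) → n → ℂ} (hu : PolyBdd u) (hf : stencilApply S L u = f) (x : Fin (d + 1) → ℤ) :
    u x = ∑' z, (invKernel S L z).mulVec (f (x - z)) := by
  rw [green_representation S L hdet hu x, hf]

/-! ### §4. Uniqueness of the tempered fundamental solution -/

omit [DecidableEq n] in
/-- the stencil operator applied to the `j`-th COLUMN of a matrix kernel `K′` is the `j`-th column of `Σ_a L_a K′(x+a)`.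
[folklore] -/
theorem stencilApply_col (K' : (Fin (d + 1) → ℤ) → Matrix n n ℂ) (j : n) (x : Fin (d + 1) → ℤ) (k : n) :
    stencilApply S L (fun y l => K' y l j) x k = (∑ a ∈ S, L a * K' (x + a)) k j := by
  rw [stencilApply_apply, Matrix.sum_apply]
  refine Finset.sum_congr rfl fun a _ => ?_
  rw [Matrix.mul_apply]

/-- the columns of the inverse kernel are (bounded, hence) polynomially bounded. [folklore] -/
theorem polyBdd_invKernel_col (hdet : ∀ s ∈ BZ (d + 1), (trigPolySymbol S L (ofRealVec s)).det ≠ 0) (j : n) :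
    PolyBdd (fun y l => invKernel S L y l j) := by
  obtain ⟨δ, M, hδ, hM, hK⟩ := invKernel_decay_l1' S L hdet
  refine PolyBdd.of_bounded (B := M) fun x k => (hK k j x).trans ?_
  have he : Real.exp (-(δ * l1 x)) ≤ 1 := by
    rw [Real.exp_le_one_iff]
    have := l1_nonneg x
    nlinarith
  calc M * Real.exp (-(δ * l1 x)) ≤ M * 1 := mul_le_mul_of_nonneg_left he hM
    _ = M := mul_one M

/-- **UNIQUENESS OF THE TEMPERED FUNDAMENTAL SOLUTION.**  A matrix kernel `K′ : ℤ^{d+1} → Mat_n(ℂ)` with polynomially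
bounded entries solving `Σ_{a ∈ S} L_a K′(x + a) = δ_{x,0}·1` IS the inverse kernel `invKernel S L` (the fibre
matrices being nonsingular on the real zone). [folklore] -/
theorem eq_invKernel_of_fundamental_left (hdet : ∀ s ∈ BZ (d + 1), (trigPolySymbol S L (ofRealVec s)).det ≠ 0)
    {K' : (Fin (d + 1) → ℤ) → Matrix n n ℂ} (hK' : ∃ C : ℝ, ∃ m : ℕ, ∀ x i j, ‖K' x i j‖ ≤ C * (1 + l1 x) ^ m)
    (hfund : ∀ x, ∑ a ∈ S, L a * K' (x + a) = if x = 0 then 1 else 0) : K' = invKernel S L := by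
  obtain ⟨C, m, hC⟩ := hK'
  funext x
  ext i j
  have hcol : (fun y l => K' y l j) = (fun y l => invKernel S L y l j) := by
    refine eq_of_stencilApply_eq S L hdet ⟨C, m, fun y l => hC y l j⟩ (polyBdd_invKernel_col S L hdet j) ?_
    funext y k
    rw [stencilApply_col, stencilApply_col, hfund y, fundamental_left S L hdet y]
  exact congrFun (congrFun hcol x) i

omit [Fintype n] [DecidableEq n] in
/-- the fibre matrices of the TRANSPOSED stencil are the transposes. [folklore] -/
theorem trigPolySymbol_transpose (p : Fin (d + 1) → ℂ) :
    trigPolySymbol S (fun a => (L a).transpose) p = (trigPolySymbol S L p).transpose := by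
  ext i j
  rw [trigPolySymbol_apply, Matrix.transpose_apply, trigPolySymbol_apply]
  rfl

/-- nonsingularity on the real zone passes to the transposed stencil. [folklore] -/
theorem hdet_transpose (hdet : ∀ s ∈ BZ (d + 1), (trigPolySymbol S L (ofRealVec s)).det ≠ 0) :
    ∀ s ∈ BZ (d + 1), (trigPolySymbol S (fun a => (L a).transpose) (ofRealVec s)).det ≠ 0 := by
  intro s hs
  rw [trigPolySymbol_transpose, Matrix.det_transpose]
  exact hdet s hs

/-- the inverse kernel of the transposed stencil is the transposed inverse kernel. [folklore] -/
theorem invKernel_transpose (x : Fin (d + 1) → ℤ) :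
    invKernel S (fun a => (L a).transpose) x = (invKernel S L x).transpose := by
  ext i j
  rw [Matrix.transpose_apply, invKernel_apply, invKernel_apply]
  congr 1
  funext p
  rw [trigPolySymbol_transpose, ← Matrix.transpose_nonsing_inv, Matrix.transpose_apply]

/-- **UNIQUENESS OF THE TEMPERED FUNDAMENTAL SOLUTION (right form).**  A matrix kernel with polynomially bounded entries
solving `Σ_{a ∈ S} K′(x + a) L_a = δ_{x,0}·1` IS `invKernel S L` (transpose the left form for the transposed stencil).
[folklore] -/
theorem eq_invKernel_of_fundamental_right (hdet : ∀ s ∈ BZ (d + 1), (trigPolySymbol S L (ofRealVec s)).det ≠ 0)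
    {K' : (Fin (d + 1) → ℤ) → Matrix n n ℂ} (hK' : ∃ C : ℝ, ∃ m : ℕ, ∀ x i j, ‖K' x i j‖ ≤ C * (1 + l1 x) ^ m)
    (hfund : ∀ x, ∑ a ∈ S, K' (x + a) * L a = if x = 0 then 1 else 0) : K' = invKernel S L := by
  obtain ⟨C, m, hC⟩ := hK'
  have hb : ∃ C : ℝ, ∃ m : ℕ, ∀ x i j, ‖(K' x).transpose i j‖ ≤ C * (1 + l1 x) ^ m :=
    ⟨C, m, fun x i j => by rw [Matrix.transpose_apply]; exact hC x j i⟩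
  have hf : ∀ x, ∑ a ∈ S, (L a).transpose * (K' (x + a)).transpose = if x = 0 then 1 else 0 := by
    intro x
    have h := congrArg Matrix.transpose (hfund x)
    rw [Matrix.transpose_sum] at h
    have hl : (∑ a ∈ S, (K' (x + a) * L a).transpose) = ∑ a ∈ S, (L a).transpose * (K' (x + a)).transpose :=
      Finset.sum_congr rfl fun a _ => Matrix.transpose_mul _ _
    have hr : (if x = 0 then (1 : Matrix n n ℂ) else 0).transpose = if x = 0 then 1 else 0 := by
      split_ifs
      · exact Matrix.transpose_one
      · exact Matrix.transpose_zero
    rw [hl, hr] at h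
    exact h
  have heq := eq_invKernel_of_fundamental_left S (fun a => (L a).transpose) (hdet_transpose S L hdet)
    (K' := fun y => (K' y).transpose) hb hf
  funext x
  have h1 : (K' x).transpose = invKernel S (fun a => (L a).transpose) x := congrFun heq x
  rw [invKernel_transpose] at h1
  exact Matrix.transpose_injective h1

/-! ### §5. Realness of the inverse kernel for real coefficient matrices -/

/-- for real coefficient matrices the entrywise complex conjugate of the inverse kernel is again a fundamental solution.
[folklore] -/
theorem fundamental_left_conj (hdet : ∀ s ∈ BZ (d + 1), (trigPolySymbol S L (ofRealVec s)).det ≠ 0)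
    (hL : ∀ a i j, (L a i j).im = 0) (x : Fin (d + 1) → ℤ) :
    ∑ a ∈ S, L a * (invKernel S L (x + a)).map (starRingEnd ℂ) = if x = 0 then 1 else 0 := by
  have hLc : ∀ a, (starRingEnd ℂ).mapMatrix (L a) = L a := by
    intro a
    ext i j
    rw [RingHom.mapMatrix_apply, Matrix.map_apply]
    exact Complex.conj_eq_iff_im.mpr (hL a i j)
  have h := congrArg (starRingEnd ℂ).mapMatrix (fundamental_left S L hdet x)
  rw [map_sum] at h
  have hl : (∑ a ∈ S, (starRingEnd ℂ).mapMatrix (L a * invKernel S L (x + a)))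
      = ∑ a ∈ S, L a * (invKernel S L (x + a)).map (starRingEnd ℂ) := by
    refine Finset.sum_congr rfl fun a _ => ?_
    rw [map_mul, hLc a, RingHom.mapMatrix_apply]
  have hr : (starRingEnd ℂ).mapMatrix (if x = 0 then (1 : Matrix n n ℂ) else 0) = if x = 0 then 1 else 0 := by
    split_ifs
    · exact map_one _
    · exact map_zero _
  rw [hl, hr] at h
  exact h

/-- **REALNESS**: for real coefficient matrices the inverse kernel is entrywise self-conjugate … [folklore] -/
theorem conj_invKernel (hdet : ∀ s ∈ BZ (d + 1), (trigPolySymbol S L (ofRealVec s)).det ≠ 0)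
    (hL : ∀ a i j, (L a i j).im = 0) (x : Fin (d + 1) → ℤ) (i j : n) :
    starRingEnd ℂ (invKernel S L x i j) = invKernel S L x i j := by
  obtain ⟨δ, M, hδ, hM, hK⟩ := invKernel_decay_l1' S L hdet
  have hb : ∃ C : ℝ, ∃ m : ℕ, ∀ x i j, ‖((invKernel S L x).map (starRingEnd ℂ)) i j‖ ≤ C * (1 + l1 x) ^ m := by
    refine ⟨M, 0, fun y i j => ?_⟩
    rw [pow_zero, mul_one, Matrix.map_apply, Complex.norm_conj]
    refine (hK i j y).trans ?_
    have he : Real.exp (-(δ * l1 y)) ≤ 1 := by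
      rw [Real.exp_le_one_iff]
      have := l1_nonneg y
      nlinarith
    calc M * Real.exp (-(δ * l1 y)) ≤ M * 1 := mul_le_mul_of_nonneg_left he hM
      _ = M := mul_one M
  have heq := eq_invKernel_of_fundamental_left S L hdet (K' := fun y => (invKernel S L y).map (starRingEnd ℂ)) hb
    (fundamental_left_conj S L hdet hL)
  have h1 : (invKernel S L x).map (starRingEnd ℂ) = invKernel S L x := congrFun heq x
  have h2 : ((invKernel S L x).map (starRingEnd ℂ)) i j = invKernel S L x i j := by rw [h1]
  rwa [Matrix.map_apply] at h2

/-- … i.e. every entry of the inverse kernel is REAL. [folklore] -/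
theorem invKernel_im_eq_zero (hdet : ∀ s ∈ BZ (d + 1), (trigPolySymbol S L (ofRealVec s)).det ≠ 0)
    (hL : ∀ a i j, (L a i j).im = 0) (x : Fin (d + 1) → ℤ) (i j : n) :
    (invKernel S L x i j).im = 0 :=
  Complex.conj_eq_iff_im.mp (conj_invKernel S L hdet hL x i j)

/-- the inverse kernel equals (the complexification of) its real part. [folklore] -/
theorem invKernel_eq_ofReal_re (hdet : ∀ s ∈ BZ (d + 1), (trigPolySymbol S L (ofRealVec s)).det ≠ 0)
    (hL : ∀ a i j, (L a i j).im = 0) (x : Fin (d + 1) → ℤ) (i j : n) :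
    invKernel S L x i j = ((invKernel S L x i j).re : ℂ) := by
  apply Complex.ext
  · simp
  · rw [Complex.ofReal_im]
    exact invKernel_im_eq_zero S L hdet hL x i j

/-- **THE REAL FUNDAMENTAL-SOLUTION IDENTITY**: for real coefficient matrices, the REAL kernel `w(x)_{lj} = Re K(x)_{lj}`
solves the real system `Σ_{a ∈ S} Σ_l Re(L_a)_{kl} · w(x + a)_{lj} = δ_{x,0} δ_{kj}` — the shape consumed by a
real-valued kernel family. [folklore] -/
theorem fundamental_left_re (hdet : ∀ s ∈ BZ (d + 1), (trigPolySymbol S L (ofRealVec s)).det ≠ 0)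
    (hL : ∀ a i j, (L a i j).im = 0) (x : Fin (d + 1) → ℤ) (k j : n) :
    ∑ a ∈ S, ∑ l, (L a k l).re * (invKernel S L (x + a) l j).re = if x = 0 ∧ k = j then 1 else 0 := by
  have h := fundamental_left S L hdet x
  have hkj : (∑ a ∈ S, L a * invKernel S L (x + a)) k j = (if x = 0 then (1 : Matrix n n ℂ) else 0) k j := by
    rw [h]
  rw [Matrix.sum_apply] at hkj
  have hre := congrArg Complex.re hkj
  rw [Complex.re_sum] at hre
  have hl : ∀ a ∈ S, (L a * invKernel S L (x + a)) k j
      = ∑ l, L a k l * invKernel S L (x + a) l j := fun a _ => Matrix.mul_apply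
  have hlhs : (∑ a ∈ S, ((L a * invKernel S L (x + a)) k j).re)
      = ∑ a ∈ S, ∑ l, (L a k l).re * (invKernel S L (x + a) l j).re := by
    refine Finset.sum_congr rfl fun a ha => ?_
    rw [hl a ha, Complex.re_sum]
    refine Finset.sum_congr rfl fun l _ => ?_
    rw [Complex.mul_re, hL a k l, zero_mul, sub_zero]
  rw [hlhs] at hre
  rw [hre]
  by_cases hx : x = 0
  · by_cases hk : k = j
    · subst hk
      simp [hx]
    · simp [hx, hk]
  · simp [hx]

/-- the real kernel inherits the (5.10)-shape exponential decay of the inverse kernel. [folklore] -/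
theorem abs_re_invKernel_le (hdet : ∀ s ∈ BZ (d + 1), (trigPolySymbol S L (ofRealVec s)).det ≠ 0) :
    ∃ δ M : ℝ, 0 < δ ∧ 0 ≤ M ∧ ∀ i j (x : Fin (d + 1) → ℤ),
      |(invKernel S L x i j).re| ≤ M * Real.exp (-(δ * l1 x)) := by
  obtain ⟨δ, M, hδ, hM, hK⟩ := invKernel_decay_l1' S L hdet
  exact ⟨δ, M, hδ, hM, fun i j x => (Complex.abs_re_le_norm _).trans (hK i j x)⟩

/-- the same in the cell's typing `B12Sec2to5.Decay510` (the hypothesis shape of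
`DecimatedMomentSummable.absMoment₂_of_decay510` / `DecimatedMomentLimit.summable_weight_mul_of_decay510`): every entry of
the real kernel has (5.10)-shape decay with common constants. [folklore] -/
theorem decay510_re_invKernel (hdet : ∀ s ∈ BZ (d + 1), (trigPolySymbol S L (ofRealVec s)).det ≠ 0) :
    ∃ δ M : ℝ, 0 < δ ∧ 0 ≤ M ∧ ∀ i j, B12Sec2to5.Decay510 (fun x => (invKernel S L x i j).re) M δ := by
  obtain ⟨δ, M, hδ, hM, hK⟩ := abs_re_invKernel_le S L hdet
  refine ⟨δ, M, hδ, hM, fun i j x => ?_⟩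
  rw [neg_mul]
  exact hK i j x

/-! ### §6. EXISTENCE: the Green potential of a tempered right-hand side is a tempered solution -/

/-- THE GREEN POTENTIAL `(K ∗ f)(x) = Σ'_z K(z) · f(x − z)` of a configuration `f`. [folklore] -/
def greenPotential (f : (Fin (d + 1) → ℤ) → n → ℂ) (x : Fin (d + 1) → ℤ) : n → ℂ :=
  ∑' z, (invKernel S L z).mulVec (f (x - z))

/-- the summand of the Green potential, componentwise: `(K(z) f(x − z))_k = Σ_l K(z)_{kl} f(x − z)_l`. [folklore] -/
theorem potential_term_apply (f : (Fin (d + 1) → ℤ) → n → ℂ) (x z : Fin (d + 1) → ℤ) (k : n) :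
    ((invKernel S L z).mulVec (f (x - z))) k = ∑ l, invKernel S L z k l * f (x - z) l := rfl

/-- the summand of the Green potential is summable (componentwise) for tempered `f`. [folklore] -/
theorem summable_potential_term (hdet : ∀ s ∈ BZ (d + 1), (trigPolySymbol S L (ofRealVec s)).det ≠ 0)
    {f : (Fin (d + 1) → ℤ) → n → ℂ} (hf : PolyBdd f) (x : Fin (d + 1) → ℤ) (k : n) :
    Summable (fun z => ((invKernel S L z).mulVec (f (x - z))) k) := by
  obtain ⟨δ, M, hδ, _, hK⟩ := invKernel_decay_l1' S L hdet
  obtain ⟨C, m, hC⟩ := hf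
  have heq : (fun z => ((invKernel S L z).mulVec (f (x - z))) k)
      = fun z => ∑ l, invKernel S L z k l * f (x - z) l := rfl
  rw [heq]
  exact summable_sum fun l _ =>
    summable_decay_mul_poly (g := fun z => invKernel S L z k l) (h := fun w => f w l) hδ (fun z => hK k l z)
      (fun w => hC w l) x

/-- … and summable as a vector-valued family. [folklore] -/
theorem summable_potential (hdet : ∀ s ∈ BZ (d + 1), (trigPolySymbol S L (ofRealVec s)).det ≠ 0)
    {f : (Fin (d + 1) → ℤ) → n → ℂ} (hf : PolyBdd f) (x : Fin (d + 1) → ℤ) :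
    Summable (fun z => (invKernel S L z).mulVec (f (x - z))) :=
  Pi.summable.mpr fun k => summable_potential_term S L hdet hf x k

/-- componentwise value of the Green potential as a double sum. [folklore] -/
theorem greenPotential_apply (hdet : ∀ s ∈ BZ (d + 1), (trigPolySymbol S L (ofRealVec s)).det ≠ 0)
    {f : (Fin (d + 1) → ℤ) → n → ℂ} (hf : PolyBdd f) (x : Fin (d + 1) → ℤ) (k : n) :
    greenPotential S L f x k = ∑ l, ∑' z, invKernel S L z k l * f (x - z) l := by
  obtain ⟨δ, M, hδ, _, hK⟩ := invKernel_decay_l1' S L hdet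
  obtain ⟨C, m, hC⟩ := hf
  unfold greenPotential
  rw [tsum_apply (summable_potential S L hdet ⟨C, m, hC⟩ x)]
  exact Summable.tsum_finsetSum fun l _ =>
    summable_decay_mul_poly (g := fun z => invKernel S L z k l) (h := fun w => f w l) hδ (fun z => hK k l z)
      (fun w => hC w l) x

/-- **THE GREEN POTENTIAL OF A TEMPERED RIGHT-HAND SIDE IS TEMPERED**, with the same polynomial degree. [folklore] -/
theorem polyBdd_greenPotential (hdet : ∀ s ∈ BZ (d + 1), (trigPolySymbol S L (ofRealVec s)).det ≠ 0)
    {f : (Fin (d + 1) → ℤ) → n → ℂ} (hf : PolyBdd f) : PolyBdd (greenPotential S L f) := by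
  obtain ⟨δ, M, hδ, _, hK⟩ := invKernel_decay_l1' S L hdet
  obtain ⟨C, m, hC⟩ := hf
  refine ⟨(Fintype.card n : ℝ) * (M * C * polyExpConst m δ * ∑' z : Fin (d + 1) → ℤ, Real.exp (-(δ / 2) * l1 z)),
    m, fun x k => ?_⟩
  rw [greenPotential_apply S L hdet ⟨C, m, hC⟩ x k]
  refine (norm_sum_le _ _).trans ?_
  calc ∑ l, ‖∑' z, invKernel S L z k l * f (x - z) l‖
      ≤ ∑ _l : n, (M * C * polyExpConst m δ * ∑' z : Fin (d + 1) → ℤ, Real.exp (-(δ / 2) * l1 z)) * (1 + l1 x) ^ m :=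
        Finset.sum_le_sum fun l _ =>
          norm_tsum_decay_mul_poly_le (g := fun z => invKernel S L z k l) (h := fun w => f w l) hδ (fun z => hK k l z)
            (fun w => hC w l) x
    _ = (Fintype.card n : ℝ) * (M * C * polyExpConst m δ * ∑' z : Fin (d + 1) → ℤ, Real.exp (-(δ / 2) * l1 z))
          * (1 + l1 x) ^ m := by
        rw [Finset.sum_const, Finset.card_univ, nsmul_eq_mul]; ring

/-- the terms `L_a_{kl} K(w + a)_{ll'} f(x − w)_{l'}` of `𝕃(K ∗ f)` are summable in `w`. [folklore] -/
theorem summable_apply_potential_term (hdet : ∀ s ∈ BZ (d + 1), (trigPolySymbol S L (ofRealVec s)).det ≠ 0)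
    {f : (Fin (d + 1) → ℤ) → n → ℂ} (hf : PolyBdd f) (x a : Fin (d + 1) → ℤ) (k l l' : n) :
    Summable (fun w => L a k l * invKernel S L (w + a) l l' * f (x - w) l') := by
  obtain ⟨δ, M, hδ, hM, hK⟩ := invKernel_decay_l1' S L hdet
  obtain ⟨C, m, hC⟩ := hf
  refine summable_decay_shift_mul_poly (g := fun z => L a k l * invKernel S L z l l') (h := fun w => f w l')
    (M := ‖L a k l‖ * M) hδ (fun z => ?_) (fun w => hC w l') x a
  rw [norm_mul, mul_assoc]
  exact mul_le_mul_of_nonneg_left (hK l l' z) (norm_nonneg _)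

/-- **EXISTENCE: THE GREEN POTENTIAL SOLVES `𝕃(K ∗ f) = f`** for every tempered right-hand side `f` (the fibre matrices
being nonsingular on the real zone). [folklore] -/
theorem stencilApply_greenPotential (hdet : ∀ s ∈ BZ (d + 1), (trigPolySymbol S L (ofRealVec s)).det ≠ 0)
    {f : (Fin (d + 1) → ℤ) → n → ℂ} (hf : PolyBdd f) : stencilApply S L (greenPotential S L f) = f := by
  funext x k
  rw [stencilApply_apply]
  -- E1: expand the potential and pull the lattice sum out of the finite sums
  have hE1 : ∀ a ∈ S, ∀ l, L a k l * greenPotential S L f (x + a) l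
      = ∑ l', ∑' z, L a k l * invKernel S L z l l' * f (x + a - z) l' := by
    intro a _ l
    rw [greenPotential_apply S L hdet hf (x + a) l, Finset.mul_sum]
    refine Finset.sum_congr rfl fun l' _ => ?_
    rw [← tsum_mul_left]
    exact tsum_congr fun z => by ring
  -- E2: re-index `z = w + a`
  have hE2 : ∀ a ∈ S, ∀ l l', (∑' z, L a k l * invKernel S L z l l' * f (x + a - z) l')
      = ∑' w, L a k l * invKernel S L (w + a) l l' * f (x - w) l' := by
    intro a _ l l'
    rw [← (Equiv.addRight a).tsum_eq (fun z => L a k l * invKernel S L z l l' * f (x + a - z) l')]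
    refine tsum_congr fun w => ?_
    simp only [Equiv.coe_addRight]
    rw [show x + a - (w + a) = x - w by abel]
  have hE12 : (∑ a ∈ S, ∑ l, L a k l * greenPotential S L f (x + a) l)
      = ∑ a ∈ S, ∑ l, ∑ l', ∑' w, L a k l * invKernel S L (w + a) l l' * f (x - w) l' := by
    refine Finset.sum_congr rfl fun a ha => Finset.sum_congr rfl fun l _ => ?_
    rw [hE1 a ha l]
    exact Finset.sum_congr rfl fun l' _ => hE2 a ha l l'
  -- E3: lattice sum outside all finite sums
  have hE3 : (∑ a ∈ S, ∑ l, ∑ l', ∑' w, L a k l * invKernel S L (w + a) l l' * f (x - w) l')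
      = ∑' w, ∑ a ∈ S, ∑ l, ∑ l', L a k l * invKernel S L (w + a) l l' * f (x - w) l' := by
    have hs : ∀ a ∈ S, ∀ l l', Summable (fun w => L a k l * invKernel S L (w + a) l l' * f (x - w) l') :=
      fun a _ l l' => summable_apply_potential_term S L hdet hf x a k l l'
    rw [Summable.tsum_finsetSum (fun a ha => summable_sum fun l _ => summable_sum fun l' _ => hs a ha l l')]
    refine Finset.sum_congr rfl fun a ha => ?_
    rw [Summable.tsum_finsetSum (fun l _ => summable_sum fun l' _ => hs a ha l l')]
    refine Finset.sum_congr rfl fun l _ => ?_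
    exact (Summable.tsum_finsetSum fun l' _ => hs a ha l l').symm
  -- E4: regroup through the fundamental-solution identity (left form)
  have hE4 : ∀ w, (∑ a ∈ S, ∑ l, ∑ l', L a k l * invKernel S L (w + a) l l' * f (x - w) l')
      = ∑ l', (if w = 0 then (1 : Matrix n n ℂ) else 0) k l' * f (x - w) l' := by
    intro w
    rw [← fundamental_left S L hdet w]
    have hr : (∑ l', (∑ a ∈ S, L a * invKernel S L (w + a)) k l' * f (x - w) l')
        = ∑ l', ∑ a ∈ S, ∑ l, L a k l * invKernel S L (w + a) l l' * f (x - w) l' := by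
      refine Finset.sum_congr rfl fun l' _ => ?_
      rw [Matrix.sum_apply, Finset.sum_mul]
      refine Finset.sum_congr rfl fun a _ => ?_
      rw [Matrix.mul_apply, Finset.sum_mul]
    rw [hr]
    symm
    rw [Finset.sum_comm]
    refine Finset.sum_congr rfl fun a _ => ?_
    exact Finset.sum_comm
  -- E5: only `w = 0` survives
  have hE5 : (∑' w, ∑ l', (if w = 0 then (1 : Matrix n n ℂ) else 0) k l' * f (x - w) l') = f x k := by
    rw [tsum_eq_single 0]
    · simp only [if_true, sub_zero, Matrix.one_apply, ite_mul, one_mul, zero_mul, Finset.sum_ite_eq,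
        Finset.mem_univ]
    · intro w hw
      simp only [hw, if_false, Matrix.zero_apply, zero_mul, Finset.sum_const_zero]
  rw [hE12, hE3, tsum_congr hE4, hE5]

/-- **THE TEMPERED SOLUTION THEORY OF `𝕃`, assembled**: for a tempered right-hand side `f`, the Green potential is a
tempered solution and every tempered solution equals it. [folklore] -/
theorem eq_greenPotential_of_stencilApply_eq (hdet : ∀ s ∈ BZ (d + 1), (trigPolySymbol S L (ofRealVec s)).det ≠ 0)
    {u f : (Fin (d + 1) → ℤ) → n → ℂ} (hu : PolyBdd u) (hf : PolyBdd f) (h : stencilApply S L u = f) :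
    u = greenPotential S L f :=
  eq_of_stencilApply_eq S L hdet hu (polyBdd_greenPotential S L hdet hf)
    (by rw [h, stencilApply_greenPotential S L hdet hf])

/-- existence and uniqueness in one line: for tempered `f` there is EXACTLY ONE tempered `u` with `𝕃u = f`. [folklore] -/
theorem existsUnique_tempered_solution (hdet : ∀ s ∈ BZ (d + 1), (trigPolySymbol S L (ofRealVec s)).det ≠ 0)
    {f : (Fin (d + 1) → ℤ) → n → ℂ} (hf : PolyBdd f) :
    ∃! u : (Fin (d + 1) → ℤ) → n → ℂ, PolyBdd u ∧ stencilApply S L u = f :=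
  ⟨greenPotential S L f, ⟨polyBdd_greenPotential S L hdet hf, stencilApply_greenPotential S L hdet hf⟩,
    fun _ hu => eq_greenPotential_of_stencilApply_eq S L hdet hu.1 hf hu.2⟩

end Green

end

end Literature.MathematicalPhysics.QuantumFieldTheory.Balaban1983to89.Beta.FibreLiouville
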